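import Mathlib
import Summits.ValiantsHypothesis.ValiantsHypothesis.Theses.FeketeSOS
import Summits.ValiantsHypothesis.ValiantsHypothesis.Theorems.FeketeSOSSublinearShadowTrivialShadow
import Summits.ValiantsHypothesis.ValiantsHypothesis.Theorems.FeketeSOSThinSquaresCovering

/-!
# `FeketeSOS.SublinearShadow` (stmt-ValiantsHypothesis-14990), line `Sketch` — THE SANDWICH, kernel-checked

The crux `SublinearShadow` (a complex representation `Σ_{i<s} c_i g_i² = F_p` of sublinear cost `S⁴ ≤ p³` has a cyclic
characteristic-`p` shadow with `≤ (s+1)^A` squares and support `≤ (s+1)^A · S`) is pinned between two X-type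
(purely complex, characteristic-zero) statements:

* `sublinearShadow_of_fewSquaresNoSublinearRep` (unconditional): if for some `ε > 0` and all large primes `p` NO
  representation with `s ≤ p^ε` squares of degree `≤ p²` has `S⁴ ≤ p³` — the thesis X at support exponent `3/4`
  restricted to `p^{o(1)}` squares — then `SublinearShadow` holds (many squares, `2p ≤ (s+1)^A · S`: the trivial
  two-square shadow `stub_trivialShadow`; few squares: `(s+1)^A · S < 2p` forces `s + 1 < (2p)^{1/A} ≤ p^{2/A} ≤ p^ε`,
  which the hypothesis excludes).
* `fewSquaresNoSublinearRep_of_sublinearShadow` (modulo a LINEAR characteristic-`p` lower bound, the conjectured true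
  form of the sibling crux (★) `CharPSparseSOS`: every cyclic representation of `F̄_p` over a field of characteristic `p`
  has total support `≥ κ·p`): `SublinearShadow` implies that same X-type statement, with `ε = 1/(8(A+1))`
  (`κ p ≤ (s+1)^A · S ≤ 2^A p^{Aε} · p^{3/4}` is absurd for large `p`).

So, modulo (★)-linear, the crux is EQUIVALENT to "X at exponent `3/4` for `p^{o(1)}` squares" — a statement with no
characteristic `p` in it, stronger in the exponent than the thesis `FeketeSOSHard` it was split from.  (The unconditional
directions already in tree: `closes` = `SublinearShadow ∧ (★) → FeketeSOSHard`; `Negative/KillCriterion`.)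
-/

namespace Summit.ValiantsHypothesis.ValiantsHypothesis.Theorems.SublinearShadowSketch

open Polynomial Finset
open scoped BigOperators

-- `Summit.ValiantsHypothesis.ValiantsHypothesis.…` is the tree's mandated single-conjunct layout (Sub = Summit).
set_option linter.dupNamespace false

/-- **Lower slice of the sandwich (unconditional).**  If for some `ε > 0` and all large primes `p` every complex
representation `Σ_{i<s} c_i g_i² = F_p` with `s ≤ p^ε` squares of degree `≤ p²` has `S⁴ > p³` (`S = Σ|supp g_i|`), then
`FeketeSOS.SublinearShadow` holds: representations with `2p ≤ (s+1)^A · S` carry the trivial two-square shadow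
(`stub_trivialShadow`), and for `A ≥ 2/ε` the others have `s + 1 < (2p)^{1/A} ≤ p^ε`, where the hypothesis leaves none. -/
theorem sublinearShadow_of_fewSquaresNoSublinearRep : (∃ ε : ℝ, 0 < ε ∧ ∃ p₁ : ℕ, ∀ (p : ℕ) [Fact p.Prime], p₁ ≤ p → ∀ (s : ℕ) (c : Fin s → ℂ) (g : Fin s → Polynomial ℂ), (s : ℝ) ≤ (p : ℝ) ^ ε → (∀ i, (g i).natDegree ≤ p ^ 2) → (∑ i, Polynomial.C (c i) * g i ^ 2) = ∑ m ∈ Finset.range p, Polynomial.C ((legendreSym p m : ℤ) : ℂ) * Polynomial.X ^ m → p ^ 3 < (∑ i, (g i).support.card) ^ 4) → Summit.ValiantsHypothesis.ValiantsHypothesis.Theses.FeketeSOS.SublinearShadow := by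
  rintro ⟨ε, hε, p₁, H⟩
  obtain ⟨A, hA⟩ : ∃ A : ℕ, 2 / ε ≤ (A : ℝ) := ⟨_, Nat.le_ceil _⟩
  unfold Summit.ValiantsHypothesis.ValiantsHypothesis.Theses.FeketeSOS.SublinearShadow
  refine ⟨A + 1, max p₁ 3, ?_⟩
  intro p _ hp s c g hdeg hS hrep
  have hprime : p.Prime := Fact.out
  have hp₁ : p₁ ≤ p := le_trans (le_max_left _ _) hp
  have hp3 : 3 ≤ p := le_trans (le_max_right _ _) hp
  have hp2 : p ≠ 2 := by omega
  set S : ℕ := ∑ i, (g i).support.card with hSdef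
  -- `S ≥ 1` from the counting bound `2(p-1) ≤ (S+1)·S`, hence `s ≥ 1`
  have hcount : 2 * (p - 1) ≤ (S + 1) * S :=
    FeketeSOSThinSquaresCovering.two_mul_pred_le_of_feketeRep p S c g
      (fun i => Finset.single_le_sum (f := fun j => (g j).support.card) (fun j _ => Nat.zero_le _)
        (Finset.mem_univ i)) hrep
  have hS1 : 1 ≤ S := by
    by_contra h0
    have h00 : S = 0 := by omega
    rw [h00] at hcount
    omega
  have hs1 : 1 ≤ s := by
    rcases Nat.eq_zero_or_pos s with h0 | h0
    · subst h0
      simp [hSdef] at hS1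
    · exact h0
  have hsA1 : (s + 1) ^ A ≤ (s + 1) ^ (A + 1) := Nat.pow_le_pow_right (Nat.succ_pos s) (Nat.le_succ A)
  by_cases hmany : 2 * p ≤ (s + 1) ^ A * S
  · -- many squares: the trivial two-square shadow over `ZMod p` is within budget
    obtain ⟨c', g', hdeg', hcard', hrep'⟩ := stub_trivialShadow p hp2
    refine ⟨ZMod p, inferInstance, inferInstance, 2, c', g', ?_, hdeg', ?_, ?_⟩
    · calc 2 ≤ s + 1 := by omega
        _ ≤ (s + 1) ^ (A + 1) := Nat.le_self_pow (Nat.succ_ne_zero A) _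
    · calc ∑ j, (g' j).support.card ≤ 2 * p := hcard'
        _ ≤ (s + 1) ^ A * S := hmany
        _ ≤ (s + 1) ^ (A + 1) * S := Nat.mul_le_mul_right _ hsA1
    · rw [hrep', sub_self]; exact dvd_zero _
  · -- few squares: `(s+1)^A < 2p` forces `s ≤ p^ε`, and the hypothesis makes this case empty
    exfalso
    push Not at hmany
    have hsA : (s + 1) ^ A < 2 * p := by
      have : (s + 1) ^ A * 1 ≤ (s + 1) ^ A * S := Nat.mul_le_mul_left _ hS1
      rw [mul_one] at this
      exact lt_of_le_of_lt this hmany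
    -- real bookkeeping: `s + 1 < (2p)^{1/A} ≤ p^{2/A} ≤ p^ε`
    have hp0 : (0 : ℝ) < (p : ℝ) := by exact_mod_cast hprime.pos
    have hp1 : (1 : ℝ) ≤ (p : ℝ) := by exact_mod_cast hprime.one_lt.le
    have hApos : (0 : ℝ) < (A : ℝ) := lt_of_lt_of_le (by positivity) hA
    have hAne : (A : ℝ) ≠ 0 := hApos.ne'
    have hsR : ((s : ℝ) + 1) ^ (A : ℕ) < 2 * (p : ℝ) := by exact_mod_cast hsA
    have hs0 : (0 : ℝ) ≤ (s : ℝ) + 1 := by positivity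
    have hs_lt : (s : ℝ) + 1 < (2 * (p : ℝ)) ^ (1 / (A : ℝ)) := by
      have h1 := Real.rpow_lt_rpow (by positivity) hsR (by positivity : (0 : ℝ) < 1 / (A : ℝ))
      rwa [← Real.rpow_natCast, ← Real.rpow_mul hs0, mul_one_div_cancel hAne, Real.rpow_one] at h1
    have h2A : 2 / (A : ℝ) ≤ ε := by
      rw [div_le_iff₀ hApos]
      have := (div_le_iff₀ hε).mp hA
      linarith
    have h2p : (2 * (p : ℝ)) ^ (1 / (A : ℝ)) ≤ (p : ℝ) ^ ε := by
      have hpp : 2 * (p : ℝ) ≤ (p : ℝ) ^ (2 : ℕ) := by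
        have : (2 : ℝ) ≤ (p : ℝ) := by exact_mod_cast hprime.two_le
        nlinarith
      calc (2 * (p : ℝ)) ^ (1 / (A : ℝ)) ≤ ((p : ℝ) ^ (2 : ℕ)) ^ (1 / (A : ℝ)) :=
            Real.rpow_le_rpow (by positivity) hpp (by positivity)
        _ = (p : ℝ) ^ (2 / (A : ℝ)) := by
            rw [← Real.rpow_natCast, ← Real.rpow_mul hp0.le]
            congr 1
            push_cast
            ring
        _ ≤ (p : ℝ) ^ ε := Real.rpow_le_rpow_of_exponent_le hp1 h2A
    have hs : (s : ℝ) ≤ (p : ℝ) ^ ε := by linarith [hs_lt.trans_le h2p]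
    exact absurd hS (not_le.mpr (H p hp₁ s c g hs hdeg hrep))

/-- **Upper slice of the sandwich (modulo (★)-linear).**  Assume the LINEAR characteristic-`p` lower bound: for some
`κ > 0` and all large primes `p`, every cyclic representation `X^p − 1 ∣ Σ_j c'_j g'_j² − F̄_p` over a field of
characteristic `p` with `deg g'_j < p` has `Σ_j |supp g'_j| ≥ κ·p` (the conjectured true form of `CharPSparseSOS`; the case
of `≤ 2` squares is the landed `feketeNoSparseCyclicSplit` with `(p+3)/2`).  Then `FeketeSOS.SublinearShadow` implies X at
exponent `3/4` for few squares: for `ε = 1/(8(A+1))` and all large `p`, every complex representation with `s ≤ p^ε`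
squares of degree `≤ p²` has `S⁴ > p³` — because a shadow of cost `≤ (s+1)^A · S ≤ 2^A p^{Aε} p^{3/4}` would cost
`≥ κ p`, i.e. `κ⁸ p ≤ 2^{8A}`. -/
theorem fewSquaresNoSublinearRep_of_sublinearShadow : (∃ κ : ℝ, 0 < κ ∧ ∃ p₀ : ℕ, ∀ (p : ℕ) [Fact p.Prime], p₀ ≤ p → ∀ (K : Type) [Field K] [CharP K p] (d : ℕ) (c' : Fin d → K) (g' : Fin d → Polynomial K), (∀ j, (g' j).natDegree < p) → ((Polynomial.X : Polynomial K) ^ p - 1 ∣ (∑ j, Polynomial.C (c' j) * g' j ^ 2) - ∑ m ∈ Finset.range p, Polynomial.C ((legendreSym p m : ℤ) : K) * Polynomial.X ^ m) → κ * (p : ℝ) ≤ ∑ j, ((g' j).support.card : ℝ)) → Summit.ValiantsHypothesis.ValiantsHypothesis.Theses.FeketeSOS.SublinearShadow → ∃ ε : ℝ, 0 < ε ∧ ∃ p₁ : ℕ, ∀ (p : ℕ) [Fact p.Prime], p₁ ≤ p → ∀ (s : ℕ) (c : Fin s → ℂ) (g : Fin s → Polynomial ℂ), (s : ℝ) ≤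 (p : ℝ) ^ ε → (∀ i, (g i).natDegree ≤ p ^ 2) → (∑ i, Polynomial.C (c i) * g i ^ 2) = ∑ m ∈ Finset.range p, Polynomial.C ((legendreSym p m : ℤ) : ℂ) * Polynomial.X ^ m → p ^ 3 < (∑ i, (g i).support.card) ^ 4 := by
  rintro ⟨κ, hκ, p₀, Hlin⟩ ⟨A, p₁, Hsh⟩
  set M : ℝ := (A : ℝ) + 1 with hM
  have hM0 : (0 : ℝ) < M := by rw [hM]; positivity
  set ε : ℝ := 1 / (8 * M) with hεdef
  have hεpos : 0 < ε := by rw [hεdef]; positivity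
  -- threshold: `2^{8A} / κ⁸ < p`
  obtain ⟨N, hN⟩ : ∃ N : ℕ, (2 : ℝ) ^ (8 * A) / κ ^ 8 ≤ (N : ℝ) := ⟨_, Nat.le_ceil _⟩
  refine ⟨ε, hεpos, max p₀ (max p₁ (N + 1)), ?_⟩
  intro p _ hp s c g hs hdeg hrep
  have hprime : p.Prime := Fact.out
  have hp₀ : p₀ ≤ p := le_trans (le_max_left _ _) hp
  have hp₁ : p₁ ≤ p := le_trans (le_trans (le_max_left _ _) (le_max_right _ _)) hp
  have hpN : N + 1 ≤ p := le_trans (le_trans (le_max_right _ _) (le_max_right _ _)) hp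
  have hp0 : (0 : ℝ) < (p : ℝ) := by exact_mod_cast hprime.pos
  have hp1 : (1 : ℝ) ≤ (p : ℝ) := by exact_mod_cast hprime.one_lt.le
  by_contra hle
  push Not at hle
  -- the shadow and its linear cost
  obtain ⟨K, instF, instC, d, c', g', _hd, hdeg', hsupp', hdvd'⟩ := Hsh p hp₁ s c g hdeg hle hrep
  have hcost := Hlin p hp₀ K d c' g' hdeg' hdvd'
  set S : ℕ := ∑ i, (g i).support.card with hSdef
  -- `κ p ≤ (s+1)^A · S` over `ℝ`
  have hT : κ * (p : ℝ) ≤ ((s : ℝ) + 1) ^ A * (S : ℝ) := by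
    have h1 : ((∑ j, (g' j).support.card : ℕ) : ℝ) ≤ (((s + 1) ^ A * S : ℕ) : ℝ) := by
      exact_mod_cast hsupp'
    push_cast at h1
    exact hcost.trans h1
  -- `S⁴ ≤ p³` over `ℝ`
  have hS4 : (S : ℝ) ^ 4 ≤ (p : ℝ) ^ 3 := by exact_mod_cast hle
  -- `s + 1 ≤ 2 p^ε`, hence `(s+1)^{4A} ≤ 2^{4A} p^{4Aε} ≤ 2^{4A} p^{1/2}`
  have hpε1 : (1 : ℝ) ≤ (p : ℝ) ^ ε := Real.one_le_rpow hp1 hεpos.le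
  have hs1 : (s : ℝ) + 1 ≤ 2 * (p : ℝ) ^ ε := by linarith
  have hs0 : (0 : ℝ) ≤ (s : ℝ) + 1 := by positivity
  have h4Aε : (4 * A : ℝ) * ε ≤ 1 / 2 := by
    rw [hεdef, hM]
    rw [show (4 * A : ℝ) * (1 / (8 * ((A : ℝ) + 1))) = (A : ℝ) / (2 * ((A : ℝ) + 1)) by
      field_simp; ring]
    rw [div_le_iff₀ (by positivity)]
    linarith
  have hpow : ((s : ℝ) + 1) ^ (4 * A) ≤ (2 : ℝ) ^ (4 * A) * (p : ℝ) ^ (1 / 2 : ℝ) := by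
    have h1 : ((s : ℝ) + 1) ^ (4 * A) ≤ (2 * (p : ℝ) ^ ε) ^ (4 * A) := pow_le_pow_left₀ hs0 hs1 _
    have e : (2 * (p : ℝ) ^ ε) ^ (4 * A) = (2 : ℝ) ^ (4 * A) * (p : ℝ) ^ ((4 * A : ℝ) * ε) := by
      rw [mul_pow, ← Real.rpow_natCast ((p : ℝ) ^ ε) (4 * A), ← Real.rpow_mul hp0.le]
      push_cast
      ring_nf
    rw [e] at h1
    have h2 : (p : ℝ) ^ ((4 * A : ℝ) * ε) ≤ (p : ℝ) ^ (1 / 2 : ℝ) :=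
      Real.rpow_le_rpow_of_exponent_le hp1 h4Aε
    exact h1.trans (mul_le_mul_of_nonneg_left h2 (by positivity))
  -- fourth power of `κ p ≤ (s+1)^A S`: `κ⁴ p⁴ ≤ (s+1)^{4A} S⁴ ≤ 2^{4A} p^{1/2} p³`
  have hκp0 : (0 : ℝ) ≤ κ * (p : ℝ) := by positivity
  have h4 : (κ * (p : ℝ)) ^ 4 ≤ (((s : ℝ) + 1) ^ A * (S : ℝ)) ^ 4 := pow_le_pow_left₀ hκp0 hT 4
  have h5 : (((s : ℝ) + 1) ^ A * (S : ℝ)) ^ 4 ≤ (2 : ℝ) ^ (4 * A) * (p : ℝ) ^ (1 / 2 : ℝ) * (p : ℝ) ^ 3 := by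
    have e : (((s : ℝ) + 1) ^ A * (S : ℝ)) ^ 4 = ((s : ℝ) + 1) ^ (4 * A) * (S : ℝ) ^ 4 := by ring
    rw [e]
    have hS0 : (0 : ℝ) ≤ (S : ℝ) ^ 4 := pow_nonneg (Nat.cast_nonneg S) 4
    have hb0 : (0 : ℝ) ≤ (2 : ℝ) ^ (4 * A) * (p : ℝ) ^ (1 / 2 : ℝ) :=
      mul_nonneg (pow_nonneg zero_le_two _) (Real.rpow_nonneg hp0.le _)
    calc ((s : ℝ) + 1) ^ (4 * A) * (S : ℝ) ^ 4
        ≤ ((2 : ℝ) ^ (4 * A) * (p : ℝ) ^ (1 / 2 : ℝ)) * (S : ℝ) ^ 4 := mul_le_mul_of_nonneg_right hpow hS0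
      _ ≤ ((2 : ℝ) ^ (4 * A) * (p : ℝ) ^ (1 / 2 : ℝ)) * (p : ℝ) ^ 3 := mul_le_mul_of_nonneg_left hS4 hb0
  have hsq : (p : ℝ) ^ (1 / 2 : ℝ) * (p : ℝ) ^ (1 / 2 : ℝ) = (p : ℝ) := by
    rw [← Real.rpow_add hp0]; norm_num
  -- square it: `κ⁸ p⁸ ≤ 2^{8A} p⁷`, i.e. `κ⁸ p ≤ 2^{8A}`
  have h6 : (κ * (p : ℝ)) ^ 8 ≤ (2 : ℝ) ^ (8 * A) * (p : ℝ) ^ 7 := by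
    have h45 := h4.trans h5
    have hl0 : (0 : ℝ) ≤ (κ * (p : ℝ)) ^ 4 := by positivity
    have hb0 : (0 : ℝ) ≤ (2 : ℝ) ^ (4 * A) * (p : ℝ) ^ (1 / 2 : ℝ) * (p : ℝ) ^ 3 := by positivity
    have hmul := mul_le_mul h45 h45 hl0 hb0
    have e1 : (κ * (p : ℝ)) ^ 8 = (κ * (p : ℝ)) ^ 4 * (κ * (p : ℝ)) ^ 4 := by ring
    have e2 : ((2 : ℝ) ^ (4 * A) * (p : ℝ) ^ (1 / 2 : ℝ) * (p : ℝ) ^ 3)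
        * ((2 : ℝ) ^ (4 * A) * (p : ℝ) ^ (1 / 2 : ℝ) * (p : ℝ) ^ 3) = (2 : ℝ) ^ (8 * A) * (p : ℝ) ^ 7 := by
      calc ((2 : ℝ) ^ (4 * A) * (p : ℝ) ^ (1 / 2 : ℝ) * (p : ℝ) ^ 3)
            * ((2 : ℝ) ^ (4 * A) * (p : ℝ) ^ (1 / 2 : ℝ) * (p : ℝ) ^ 3)
            = ((2 : ℝ) ^ (4 * A) * (2 : ℝ) ^ (4 * A)) * ((p : ℝ) ^ (1 / 2 : ℝ) * (p : ℝ) ^ (1 / 2 : ℝ))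
              * ((p : ℝ) ^ 3 * (p : ℝ) ^ 3) := by ring
        _ = ((2 : ℝ) ^ (4 * A) * (2 : ℝ) ^ (4 * A)) * (p : ℝ) * ((p : ℝ) ^ 3 * (p : ℝ) ^ 3) := by rw [hsq]
        _ = (2 : ℝ) ^ (8 * A) * (p : ℝ) ^ 7 := by ring
    rw [e1, ← e2]
    exact hmul
  have h7 : κ ^ 8 * (p : ℝ) ≤ (2 : ℝ) ^ (8 * A) := by
    have hp7 : (0 : ℝ) < (p : ℝ) ^ 7 := by positivity
    have : κ ^ 8 * (p : ℝ) * (p : ℝ) ^ 7 ≤ (2 : ℝ) ^ (8 * A) * (p : ℝ) ^ 7 := by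
      calc κ ^ 8 * (p : ℝ) * (p : ℝ) ^ 7 = (κ * (p : ℝ)) ^ 8 := by ring
        _ ≤ (2 : ℝ) ^ (8 * A) * (p : ℝ) ^ 7 := h6
    exact le_of_mul_le_mul_right this hp7
  -- contradiction with the threshold `N < p`
  have hκ8 : (0 : ℝ) < κ ^ 8 := by positivity
  have hpR : (N : ℝ) + 1 ≤ (p : ℝ) := by exact_mod_cast hpN
  have : (p : ℝ) ≤ (2 : ℝ) ^ (8 * A) / κ ^ 8 := by
    rw [le_div_iff₀ hκ8]; linarith [h7]
  linarith [this, hN, hpR]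

/-- **Upper slice of the sandwich, sharp form (modulo (★) beyond exponent `3/4`, few squares).**  Assume only
this: for some `δ, η > 0` and all large primes `p`, every cyclic representation `X^p − 1 ∣ Σ_j c'_j g'_j² − F̄_p` over
a field of characteristic `p` with `d ≤ p^δ` squares of degree `< p` has total support `≥ p^{3/4 + η}` — the sibling
crux (★) `CharPSparseSOS` with its support exponent `1/2 + δ` raised to `3/4 + η` (weaker than the LINEAR form used in
`fewSquaresNoSublinearRep_of_sublinearShadow`).  Then `FeketeSOS.SublinearShadow` already implies X at exponent `3/4`
for few squares: with `A, p₁` from the shadow and `ε = min δ η / (2(A+1))`, a complex representation with `s ≤ p^ε`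
squares and `S⁴ ≤ p³` would have a shadow with `d ≤ (s+1)^A ≤ 2^A p^{Aε} ≤ p^δ` squares and support
`≤ (s+1)^A · S ≤ 2^A p^{Aε} p^{3/4}`, so `p^{3/4+η} ≤ 2^A p^{η/2} p^{3/4}`, i.e. `p^{η/2} ≤ 2^A` — false for large `p`.
So the crux has content independent of X(3/4, few squares) only if (★) FAILS strictly between the exponents `3/4`
and `1` (cheap cyclic characteristic-`p` representations of `F̄_p` with `p^{o(1)}` squares and support `p^{3/4+o(1)}`),
the reading recorded in prose by continuation lead c7 (`Cruxes/SublinearShadow/Lines/Sketch-dead.md`, v6 §2′(iii)). -/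
theorem fewSquaresNoSublinearRep_of_sublinearShadow_threeQuarters :
    (∃ δ : ℝ, 0 < δ ∧ ∃ η : ℝ, 0 < η ∧ ∃ p₀ : ℕ, ∀ (p : ℕ) [Fact p.Prime], p₀ ≤ p →
      ∀ (K : Type) [Field K] [CharP K p] (d : ℕ) (c' : Fin d → K) (g' : Fin d → Polynomial K),
      (d : ℝ) ≤ (p : ℝ) ^ δ → (∀ j, (g' j).natDegree < p) →
      ((Polynomial.X : Polynomial K) ^ p - 1 ∣ (∑ j, Polynomial.C (c' j) * g' j ^ 2)
        - ∑ m ∈ Finset.range p, Polynomial.C ((legendreSym p m : ℤ) : K) * Polynomial.X ^ m) →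
      (p : ℝ) ^ (3 / 4 + η) ≤ ∑ j, ((g' j).support.card : ℝ)) →
    Summit.ValiantsHypothesis.ValiantsHypothesis.Theses.FeketeSOS.SublinearShadow →
    ∃ ε : ℝ, 0 < ε ∧ ∃ p₁ : ℕ, ∀ (p : ℕ) [Fact p.Prime], p₁ ≤ p →
      ∀ (s : ℕ) (c : Fin s → ℂ) (g : Fin s → Polynomial ℂ), (s : ℝ) ≤ (p : ℝ) ^ ε →
      (∀ i, (g i).natDegree ≤ p ^ 2) →
      (∑ i, Polynomial.C (c i) * g i ^ 2)
        = ∑ m ∈ Finset.range p, Polynomial.C ((legendreSym p m : ℤ) : ℂ) * Polynomial.X ^ m →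
      p ^ 3 < (∑ i, (g i).support.card) ^ 4 := by
  rintro ⟨δ, hδ, η, hη, p₀, Hstar⟩ ⟨A, p₁, Hsh⟩
  -- exponents: `θ = min δ η / 2`, `ε = θ / (A+1)`, so that `A ε ≤ θ ≤ δ/2, η/2`
  set θ : ℝ := min δ η / 2 with hθdef
  have hminpos : 0 < min δ η := lt_min hδ hη
  have hθpos : 0 < θ := by rw [hθdef]; positivity
  have hθδ : θ ≤ δ / 2 := by
    rw [hθdef]; exact div_le_div_of_nonneg_right (min_le_left _ _) (by norm_num)
  have hθη : θ ≤ η / 2 := by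
    rw [hθdef]; exact div_le_div_of_nonneg_right (min_le_right _ _) (by norm_num)
  set M : ℝ := (A : ℝ) + 1 with hM
  have hM0 : (0 : ℝ) < M := by rw [hM]; positivity
  set ε : ℝ := θ / M with hεdef
  have hεpos : 0 < ε := by rw [hεdef]; positivity
  have hAε : (A : ℝ) * ε ≤ θ := by
    rw [hεdef, mul_div_assoc']
    rw [div_le_iff₀ hM0, hM]
    nlinarith [hθpos.le]
  -- threshold: `2^A < p^θ` as soon as `B + 1 ≤ p` where `B = (2^A)^{1/θ}`
  set B : ℝ := ((2 : ℝ) ^ (A : ℕ)) ^ (1 / θ) with hBdef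
  have hB0 : 0 ≤ B := by rw [hBdef]; positivity
  obtain ⟨N, hN⟩ : ∃ N : ℕ, B ≤ (N : ℝ) := ⟨_, Nat.le_ceil _⟩
  refine ⟨ε, hεpos, max p₀ (max p₁ (N + 1)), ?_⟩
  intro p _ hp s c g hs hdeg hrep
  have hprime : p.Prime := Fact.out
  have hp₀ : p₀ ≤ p := le_trans (le_max_left _ _) hp
  have hp₁ : p₁ ≤ p := le_trans (le_trans (le_max_left _ _) (le_max_right _ _)) hp
  have hpN : N + 1 ≤ p := le_trans (le_trans (le_max_right _ _) (le_max_right _ _)) hp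
  have hp0 : (0 : ℝ) < (p : ℝ) := by exact_mod_cast hprime.pos
  have hp1 : (1 : ℝ) ≤ (p : ℝ) := by exact_mod_cast hprime.one_lt.le
  -- `2^A < p^θ`
  have h2A : (2 : ℝ) ^ (A : ℕ) < (p : ℝ) ^ θ := by
    have hBp : B < (p : ℝ) := by
      have : (N : ℝ) + 1 ≤ (p : ℝ) := by exact_mod_cast hpN
      linarith
    have h1 : B ^ θ < (p : ℝ) ^ θ := Real.rpow_lt_rpow hB0 hBp hθpos
    have e : B ^ θ = (2 : ℝ) ^ (A : ℕ) := by
      rw [hBdef, ← Real.rpow_mul (by positivity), one_div_mul_cancel hθpos.ne', Real.rpow_one]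
    rwa [e] at h1
  by_contra hle
  push Not at hle
  -- the shadow
  obtain ⟨K, instF, instC, d, c', g', hd, hdeg', hsupp', hdvd'⟩ := Hsh p hp₁ s c g hdeg hle hrep
  set S : ℕ := ∑ i, (g i).support.card with hSdef
  -- `s + 1 ≤ 2 p^ε`, `(s+1)^A ≤ 2^A p^{Aε} ≤ 2^A p^θ`
  have hpε1 : (1 : ℝ) ≤ (p : ℝ) ^ ε := Real.one_le_rpow hp1 hεpos.le
  have hs1 : (s : ℝ) + 1 ≤ 2 * (p : ℝ) ^ ε := by linarith
  have hs0 : (0 : ℝ) ≤ (s : ℝ) + 1 := by positivity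
  have hpow : ((s : ℝ) + 1) ^ (A : ℕ) ≤ (2 : ℝ) ^ (A : ℕ) * (p : ℝ) ^ θ := by
    have h1 : ((s : ℝ) + 1) ^ (A : ℕ) ≤ (2 * (p : ℝ) ^ ε) ^ (A : ℕ) := pow_le_pow_left₀ hs0 hs1 _
    have e : (2 * (p : ℝ) ^ ε) ^ (A : ℕ) = (2 : ℝ) ^ (A : ℕ) * (p : ℝ) ^ ((A : ℝ) * ε) := by
      rw [mul_pow, ← Real.rpow_natCast ((p : ℝ) ^ ε) A, ← Real.rpow_mul hp0.le]
      ring_nf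
    rw [e] at h1
    have h2 : (p : ℝ) ^ ((A : ℝ) * ε) ≤ (p : ℝ) ^ θ := Real.rpow_le_rpow_of_exponent_le hp1 hAε
    exact h1.trans (mul_le_mul_of_nonneg_left h2 (by positivity))
  -- few squares on the characteristic-`p` side: `d ≤ (s+1)^A ≤ 2^A p^θ < p^θ p^θ ≤ p^δ`
  have hθθ : (p : ℝ) ^ θ * (p : ℝ) ^ θ ≤ (p : ℝ) ^ δ := by
    rw [← Real.rpow_add hp0]
    exact Real.rpow_le_rpow_of_exponent_le hp1 (by linarith)
  have hpθ0 : (0 : ℝ) < (p : ℝ) ^ θ := Real.rpow_pos_of_pos hp0 θ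
  have hdR : (d : ℝ) ≤ (p : ℝ) ^ δ := by
    have h1 : (d : ℝ) ≤ ((s : ℝ) + 1) ^ (A : ℕ) := by exact_mod_cast hd
    have h2 : (2 : ℝ) ^ (A : ℕ) * (p : ℝ) ^ θ ≤ (p : ℝ) ^ θ * (p : ℝ) ^ θ :=
      mul_le_mul_of_nonneg_right h2A.le hpθ0.le
    exact h1.trans (hpow.trans (h2.trans hθθ))
  -- (★) beyond 3/4 applied to the shadow
  have hcost := Hstar p hp₀ K d c' g' hdR hdeg' hdvd'
  -- `p^{3/4+η} ≤ (s+1)^A · S ≤ 2^A p^θ · p^{3/4}`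
  have hT : (p : ℝ) ^ (3 / 4 + η) ≤ ((s : ℝ) + 1) ^ (A : ℕ) * (S : ℝ) := by
    have h1 : ((∑ j, (g' j).support.card : ℕ) : ℝ) ≤ (((s + 1) ^ A * S : ℕ) : ℝ) := by
      exact_mod_cast hsupp'
    push_cast at h1
    exact hcost.trans h1
  have hS34 : (S : ℝ) ≤ (p : ℝ) ^ (3 / 4 : ℝ) := by
    have hS4 : (S : ℝ) ^ (4 : ℕ) ≤ (p : ℝ) ^ (3 : ℕ) := by exact_mod_cast hle
    have hS0 : (0 : ℝ) ≤ (S : ℝ) := Nat.cast_nonneg S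
    have hq0 : (0 : ℝ) ≤ (1 / 4 : ℝ) := by norm_num
    have hS40 : (0 : ℝ) ≤ (S : ℝ) ^ (4 : ℕ) := pow_nonneg hS0 4
    have h1 : ((S : ℝ) ^ (4 : ℕ)) ^ (1 / 4 : ℝ) ≤ ((p : ℝ) ^ (3 : ℕ)) ^ (1 / 4 : ℝ) :=
      Real.rpow_le_rpow hS40 hS4 hq0
    have e1 : ((S : ℝ) ^ (4 : ℕ)) ^ (1 / 4 : ℝ) = (S : ℝ) := by
      rw [← Real.rpow_natCast (S : ℝ) 4, ← Real.rpow_mul hS0]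
      norm_num
    have e2 : ((p : ℝ) ^ (3 : ℕ)) ^ (1 / 4 : ℝ) = (p : ℝ) ^ (3 / 4 : ℝ) := by
      rw [← Real.rpow_natCast (p : ℝ) 3, ← Real.rpow_mul hp0.le]
      norm_num
    rwa [e1, e2] at h1
  have hp34 : (0 : ℝ) < (p : ℝ) ^ (3 / 4 : ℝ) := Real.rpow_pos_of_pos hp0 _
  have hchain : (p : ℝ) ^ (3 / 4 : ℝ) * (p : ℝ) ^ η ≤ (p : ℝ) ^ (3 / 4 : ℝ) * ((2 : ℝ) ^ (A : ℕ) * (p : ℝ) ^ θ) := by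
    calc (p : ℝ) ^ (3 / 4 : ℝ) * (p : ℝ) ^ η = (p : ℝ) ^ (3 / 4 + η) := by rw [← Real.rpow_add hp0]
      _ ≤ ((s : ℝ) + 1) ^ (A : ℕ) * (S : ℝ) := hT
      _ ≤ ((2 : ℝ) ^ (A : ℕ) * (p : ℝ) ^ θ) * (p : ℝ) ^ (3 / 4 : ℝ) :=
          mul_le_mul hpow hS34 (Nat.cast_nonneg S) (by positivity)
      _ = (p : ℝ) ^ (3 / 4 : ℝ) * ((2 : ℝ) ^ (A : ℕ) * (p : ℝ) ^ θ) := by ring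
  have hη1 : (p : ℝ) ^ η ≤ (2 : ℝ) ^ (A : ℕ) * (p : ℝ) ^ θ := le_of_mul_le_mul_left hchain hp34
  -- `p^η = p^{η/2} p^{η/2} ≥ p^θ p^θ > 2^A p^θ`: contradiction
  have hη2 : (p : ℝ) ^ θ * (p : ℝ) ^ θ ≤ (p : ℝ) ^ η := by
    rw [← Real.rpow_add hp0]
    exact Real.rpow_le_rpow_of_exponent_le hp1 (by linarith)
  have : (p : ℝ) ^ θ * (p : ℝ) ^ θ < (p : ℝ) ^ θ * (p : ℝ) ^ θ :=
    calc (p : ℝ) ^ θ * (p : ℝ) ^ θ ≤ (p : ℝ) ^ η := hη2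
      _ ≤ (2 : ℝ) ^ (A : ℕ) * (p : ℝ) ^ θ := hη1
      _ < (p : ℝ) ^ θ * (p : ℝ) ^ θ := mul_lt_mul_of_pos_right h2A hpθ0
  exact lt_irrefl _ this

end Summit.ValiantsHypothesis.ValiantsHypothesis.Theorems.SublinearShadowSketch
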